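import Summits.CriticalPhenomena.Ising3DConformalLimit.Theorems.MoebiusLimitExists.Negative.FreeTranslations

/-!
# `RotationUpgradeFromTwoPoint` (item stmt-CriticalPhenomena-8367): CONTINUITY of the limit is AUTOMATIC

Structural knowledge about the crux
`Summit.CriticalPhenomena.Ising3DConformalLimit.Theses.GaussianScaleMixture.RotationUpgradeFromTwoPoint`
(standing crux disprover, D-0016, cycle 1; THEOREM-ONLY). For ANY pointwise scaling limit `S` of the
critical correlators on `ℤ³` (any renormalisation `ρ`, no other hypothesis), every `S n` is CONTINUOUS on
the non-coincident configurations (`limit_continuousOn`). So the continuity clause in the blocked class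
of `Negative/LoadBearingHypotheses.lean` (`not_cruxWithCubicLatticeLimit`) is met by every instance of the
crux, and lines that need continuity of the limit (e.g. "a `B₃`-invariant CONTINUOUS family invariant under
one more rotation of finite order is `SO(3)` invariant") get it for free.

Mechanism (`exists_shift_floor_eq`, `exists_cellmate_shift`): the rescaled correlators are step functions
on the mesh-`δ` cells, and locally uniform convergence alone does not make a limit of step functions
continuous; but the plus state is translation invariant, so `S` is translation invariant on
`NonCoincident` (tree `limit_translate`), and for two nearby configurations `x, y` (all `3n` coordinates
within `δ/(n+1)`) a COMMON real shift `w` with `x + w`, `y + w` in the same mesh-`δ` cells always exists: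
per coordinate axis the bad shifts form `n` arcs of length `< δ/(n+1)`, which cannot contain two of the
`n + 1` equally spaced candidates `mδ/(n+1)` (pigeonhole). Then
`S y = S (y + w) ≈ F_δ (y + w) = F_δ (x + w) ≈ S (x + w) = S x`.
-/

noncomputable section

namespace Summit.CriticalPhenomena.Ising3DConformalLimit.RotationUpgradeFromTwoPointNegative

open Literature.Probability.LatticeModels
open Filter Set Function
open Summit.CriticalPhenomena.Ising3DConformalLimit.MoebiusLimitExistsNegative
open scoped Topology

variable {ρ : ℝ → ℝ} {S : CorrFamily 3}

/-! ## The pigeonhole on one axis -/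

/-- Core of the pigeonhole: if `lo ≤ hi < lo + L` and two shifts `s, s'` with
`L ≤ s' - s ≤ 1 - L` BOTH put a cell wall between `lo` and `hi`, the two walls are integers at
distance in `(0, 1)` — impossible. [folklore] -/
theorem floor_walls_aux {lo hi s s' L : ℝ} (hlohi : lo ≤ hi) (hL : hi - lo < L) (h1 : L ≤ s' - s)
    (h2 : s' - s ≤ 1 - L) (hs : ⌊lo + s⌋ ≠ ⌊hi + s⌋) (hs' : ⌊lo + s'⌋ ≠ ⌊hi + s'⌋) : False := by
  have hk : ⌊lo + s⌋ < ⌊hi + s⌋ := lt_of_le_of_ne (Int.floor_mono (by linarith)) hs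
  have hk' : ⌊lo + s'⌋ < ⌊hi + s'⌋ := lt_of_le_of_ne (Int.floor_mono (by linarith)) hs'
  -- `lo + s < ⌊hi + s⌋ ≤ hi + s` and `lo + s' < ⌊hi + s'⌋ ≤ hi + s'`
  have hk1 : lo + s < ((⌊hi + s⌋ : ℤ) : ℝ) := by
    have h := Int.lt_floor_add_one (lo + s)
    have h' : ((⌊lo + s⌋ + 1 : ℤ) : ℝ) ≤ ((⌊hi + s⌋ : ℤ) : ℝ) := by exact_mod_cast hk
    push_cast at h'
    linarith
  have hk2 : ((⌊hi + s⌋ : ℤ) : ℝ) ≤ hi + s := Int.floor_le _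
  have hk1' : lo + s' < ((⌊hi + s'⌋ : ℤ) : ℝ) := by
    have h := Int.lt_floor_add_one (lo + s')
    have h' : ((⌊lo + s'⌋ + 1 : ℤ) : ℝ) ≤ ((⌊hi + s'⌋ : ℤ) : ℝ) := by exact_mod_cast hk'
    push_cast at h'
    linarith
  have hk2' : ((⌊hi + s'⌋ : ℤ) : ℝ) ≤ hi + s' := Int.floor_le _
  have h3 : (0 : ℤ) < ⌊hi + s'⌋ - ⌊hi + s⌋ := by
    have : (0 : ℝ) < ((⌊hi + s'⌋ : ℤ) : ℝ) - ((⌊hi + s⌋ : ℤ) : ℝ) := by linarith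
    exact_mod_cast this
  have h4 : ⌊hi + s'⌋ - ⌊hi + s⌋ < (1 : ℤ) := by
    have : ((⌊hi + s'⌋ : ℤ) : ℝ) - ((⌊hi + s⌋ : ℤ) : ℝ) < 1 := by linarith
    exact_mod_cast this
  omega

/-- Symmetric form of `floor_walls_aux`. [folklore] -/
theorem floor_walls {a b s s' L : ℝ} (hL : |a - b| < L) (h1 : L ≤ s' - s) (h2 : s' - s ≤ 1 - L)
    (hs : ⌊a + s⌋ ≠ ⌊b + s⌋) (hs' : ⌊a + s'⌋ ≠ ⌊b + s'⌋) : False := by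
  rcases le_total a b with hab | hab
  · have : b - a < L := by
      rw [abs_sub_comm] at hL
      exact lt_of_le_of_lt (le_abs_self _) hL
    exact floor_walls_aux hab this h1 h2 hs hs'
  · have : a - b < L := lt_of_le_of_lt (le_abs_self _) hL
    exact floor_walls_aux hab this h1 h2 (Ne.symm hs) (Ne.symm hs')

/-- **One-axis pigeonhole.** For `n` pairs of reals within `1/(n+1)` of each other there is a common
shift `s ∈ [0, 1)` after which each pair lies in the same unit cell. [folklore] -/
theorem exists_shift_floor_eq {n : ℕ} (a b : Fin n → ℝ) (hab : ∀ i, |a i - b i| < 1 / (n + 1)) :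
    ∃ s : ℝ, 0 ≤ s ∧ s < 1 ∧ ∀ i, ⌊a i + s⌋ = ⌊b i + s⌋ := by
  by_contra hcon
  push Not at hcon
  have hn1 : (0 : ℝ) < n + 1 := by positivity
  -- every candidate `m/(n+1)` has a bad index
  have hbad : ∀ m : Fin (n + 1), ∃ i, ⌊a i + (m : ℝ) / (n + 1)⌋ ≠ ⌊b i + (m : ℝ) / (n + 1)⌋ := by
    intro m
    refine hcon _ (by positivity) ?_
    rw [div_lt_one hn1]
    exact_mod_cast m.is_lt
  choose f hf using hbad
  obtain ⟨m, m', hne, hfe⟩ := Fintype.exists_ne_map_eq_of_card_lt f (by simp)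
  -- two candidates with the same bad index contradict `floor_walls`
  have key : ∀ m m' : Fin (n + 1), m < m' → f m = f m' → False := by
    intro m m' hlt hfeq
    have hmm' : (m : ℝ) + 1 ≤ m' := by exact_mod_cast (Nat.succ_le_of_lt hlt)
    have hm'n : (m' : ℝ) ≤ n := by exact_mod_cast (Nat.le_of_lt_succ m'.is_lt)
    have hm0 : (0 : ℝ) ≤ m := by positivity
    have hfm' := hf m'
    rw [← hfeq] at hfm'
    refine floor_walls (L := 1 / (n + 1)) (s := (m : ℝ) / (n + 1)) (s' := (m' : ℝ) / (n + 1))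
      (hab (f m)) ?_ ?_ (hf m) hfm'
    · rw [div_sub_div_same, div_le_div_iff_of_pos_right hn1]
      linarith
    · rw [div_sub_div_same, one_sub_div hn1.ne', div_le_div_iff_of_pos_right hn1]
      linarith
  rcases lt_or_gt_of_ne hne with hlt | hlt
  · exact key m m' hlt hfe
  · exact key m' m hlt hfe.symm

/-! ## The common cellmate shift in `ℝ³` -/

/-- A coordinate is bounded by the Euclidean norm. [folklore] -/
theorem abs_apply_le_norm (v : EuclideanSpace ℝ (Fin 3)) (j : Fin 3) : |v j| ≤ ‖v‖ := by
  rw [EuclideanSpace.norm_eq]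
  have h : |v j| = Real.sqrt (‖v j‖ ^ 2) := by
    rw [Real.norm_eq_abs, Real.sqrt_sq (abs_nonneg _)]
  rw [h]
  exact Real.sqrt_le_sqrt
    (Finset.single_le_sum (f := fun k => ‖v k‖ ^ 2) (fun _ _ => sq_nonneg _) (Finset.mem_univ j))

/-- **Cellmate shift.** If two configurations of `n` points in `ℝ³` have all coordinates within
`δ/(n+1)`, a common shift `w` (`‖w‖ ≤ 2δ`) puts `x + w` and `y + w` in the same mesh-`δ` cells:
`⌊(xᵢ + w)ⱼ/δ⌋ = ⌊(yᵢ + w)ⱼ/δ⌋` for all `i, j`. [folklore] -/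
theorem exists_cellmate_shift {n : ℕ} {δ : ℝ} (hδ : 0 < δ) (x y : Fin n → EuclideanSpace ℝ (Fin 3))
    (hxy : ∀ i j, |x i j - y i j| < δ / (n + 1)) :
    ∃ w : EuclideanSpace ℝ (Fin 3), ‖w‖ ≤ 2 * δ ∧ ∀ i j, ⌊(x i + w) j / δ⌋ = ⌊(y i + w) j / δ⌋ := by
  have hn1 : (0 : ℝ) < n + 1 := by positivity
  have h : ∀ j : Fin 3, ∃ s : ℝ, 0 ≤ s ∧ s < 1 ∧ ∀ i, ⌊x i j / δ + s⌋ = ⌊y i j / δ + s⌋ := by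
    intro j
    refine exists_shift_floor_eq (fun i => x i j / δ) (fun i => y i j / δ) fun i => ?_
    have h1 : |x i j / δ - y i j / δ| = |x i j - y i j| / δ := by
      rw [← sub_div, abs_div, abs_of_pos hδ]
    rw [h1, div_lt_iff₀ hδ]
    calc |x i j - y i j| < δ / (n + 1) := hxy i j
      _ = 1 / (n + 1) * δ := by ring
  choose s hs0 hs1 hs using h
  set w : EuclideanSpace ℝ (Fin 3) := WithLp.toLp 2 (fun j => δ * s j) with hw
  have hwj : ∀ j, w j = δ * s j := fun j => rfl
  refine ⟨w, ?_, fun i j => ?_⟩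
  · rw [EuclideanSpace.norm_eq]
    have hle : ∑ k : Fin 3, ‖w k‖ ^ 2 ≤ (2 * δ) ^ 2 := by
      have hk : ∀ k : Fin 3, ‖w k‖ ^ 2 ≤ δ ^ 2 := by
        intro k
        rw [hwj, Real.norm_eq_abs, sq_abs]
        have h0 := hs0 k
        have h1 := hs1 k
        have hs2 : s k ^ 2 ≤ 1 := by nlinarith
        calc (δ * s k) ^ 2 = δ ^ 2 * s k ^ 2 := by ring
          _ ≤ δ ^ 2 * 1 := mul_le_mul_of_nonneg_left hs2 (sq_nonneg _)
          _ = δ ^ 2 := mul_one _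
      calc ∑ k : Fin 3, ‖w k‖ ^ 2 ≤ ∑ _k : Fin 3, δ ^ 2 := Finset.sum_le_sum fun k _ => hk k
        _ = 3 * δ ^ 2 := by simp
        _ ≤ (2 * δ) ^ 2 := by nlinarith [hδ]
    calc Real.sqrt (∑ k : Fin 3, ‖w k‖ ^ 2) ≤ Real.sqrt ((2 * δ) ^ 2) := Real.sqrt_le_sqrt hle
      _ = 2 * δ := Real.sqrt_sq (by linarith)
  · have hx : (x i + w) j / δ = x i j / δ + s j := by
      have : (x i + w) j = x i j + δ * s j := by rw [← hwj]; rfl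
      rw [this, add_div, mul_div_cancel_left₀ _ hδ.ne']
    have hy : (y i + w) j / δ = y i j / δ + s j := by
      have : (y i + w) j = y i j + δ * s j := by rw [← hwj]; rfl
      rw [this, add_div, mul_div_cancel_left₀ _ hδ.ne']
    rw [hx, hy]
    exact hs j i

/-- Cellmates have the same rescaled correlator (any lattice family). [folklore] -/
theorem rescaledCorrelator_eq_of_cellmates (G : LatticeCorrFamily 3) (ρ : ℝ → ℝ) {n : ℕ} (δ : ℝ)
    {x y : Fin n → EuclideanSpace ℝ (Fin 3)} (h : ∀ i j, ⌊x i j / δ⌋ = ⌊y i j / δ⌋) :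
    rescaledCorrelator G ρ n δ x = rescaledCorrelator G ρ n δ y := by
  rw [rescaledCorrelator_apply, rescaledCorrelator_apply]
  congr 2
  funext i
  funext j
  rw [latticeApprox_apply, latticeApprox_apply, h i j]

/-! ## Continuity of every limit -/

/-- **Continuity is FREE**: for ANY pointwise scaling limit `S` of the critical correlators on `ℤ³`
(any `ρ`), every `S n` is continuous on `NonCoincident 3 n`. [cite: FriedliVelenik2017, Thm. 3.17] -/
theorem limit_continuousOn (hlim : HasPointwiseScalingLimit (criticalCorr 3) ρ S) (n : ℕ) :
    ContinuousOn (S n) (NonCoincident 3 n) := by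
  intro x₀ hx₀
  rw [Metric.continuousWithinAt_iff]
  intro ε hε
  have hε3 : 0 < ε / 3 := by positivity
  have hU := hlim n
  rw [Metric.tendstoLocallyUniformlyOn_iff] at hU
  obtain ⟨t, ht, hev⟩ := hU (ε / 3) hε3 x₀ hx₀
  obtain ⟨r, hr, hsub⟩ := Metric.mem_nhdsWithin_iff.1 ht
  -- a mesh `δ < r/4` at which the uniform estimate holds on `t`
  have hr4 : (0 : ℝ) < r / 4 := by positivity
  obtain ⟨δ, hPδ, hδmem⟩ := (hev.and (Ioo_mem_nhdsGT hr4)).exists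
  have hδ : 0 < δ := hδmem.1
  have hδr : δ < r / 4 := hδmem.2
  have hn1 : (0 : ℝ) < n + 1 := by positivity
  refine ⟨δ / (n + 1), by positivity, fun {y} hy hdist => ?_⟩
  -- coordinates of `y` and `x₀` are within `δ/(n+1)`
  have hcoord : ∀ i j, |x₀ i j - y i j| < δ / (n + 1) := by
    intro i j
    have hi : dist (y i) (x₀ i) < δ / (n + 1) := (dist_pi_lt_iff (by positivity)).1 hdist i
    rw [dist_eq_norm] at hi
    calc |x₀ i j - y i j| = |(y i - x₀ i) j| := by
            rw [abs_sub_comm]; rfl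
      _ ≤ ‖y i - x₀ i‖ := abs_apply_le_norm _ _
      _ < δ / (n + 1) := hi
  obtain ⟨w, hwnorm, hcell⟩ := exists_cellmate_shift hδ x₀ y hcoord
  -- the shifted configurations lie in `ball x₀ r ∩ NonCoincident`, hence in `t`
  have hδn : δ / (n + 1) ≤ δ := div_le_self hδ.le (by linarith)
  have hx' : (fun i => x₀ i + w) ∈ t := by
    refine hsub ⟨?_, (add_mem_nonCoincident_iff w x₀).2 hx₀⟩
    rw [Metric.mem_ball]
    rcases Nat.eq_zero_or_pos n with hn | hn
    · subst hn
      have : (fun i : Fin 0 => x₀ i + w) = x₀ := funext fun i => i.elim0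
      rw [this, dist_self]; exact hr
    · haveI : Nonempty (Fin n) := ⟨⟨0, hn⟩⟩
      refine (dist_pi_lt_iff hr).2 fun i => ?_
      rw [dist_eq_norm, add_sub_cancel_left]
      linarith
  have hy' : (fun i => y i + w) ∈ t := by
    refine hsub ⟨?_, (add_mem_nonCoincident_iff w y).2 hy⟩
    rw [Metric.mem_ball]
    rcases Nat.eq_zero_or_pos n with hn | hn
    · subst hn
      have : (fun i : Fin 0 => y i + w) = x₀ := funext fun i => i.elim0
      rw [this, dist_self]; exact hr
    · haveI : Nonempty (Fin n) := ⟨⟨0, hn⟩⟩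
      refine (dist_pi_lt_iff hr).2 fun i => ?_
      have hi : dist (y i) (x₀ i) < δ / (n + 1) := (dist_pi_lt_iff (by positivity)).1 hdist i
      calc dist (y i + w) (x₀ i) ≤ dist (y i + w) (y i) + dist (y i) (x₀ i) := dist_triangle _ _ _
        _ = ‖w‖ + dist (y i) (x₀ i) := by rw [dist_eq_norm, add_sub_cancel_left]
        _ < r := by linarith
  -- assemble: `S y = S (y+w) ≈ F (y+w) = F (x₀+w) ≈ S (x₀+w) = S x₀`
  have h1 := hPδ _ hx'
  have h2 := hPδ _ hy'
  have hF : rescaledCorrelator (criticalCorr 3) ρ n δ (fun i => x₀ i + w) =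
      rescaledCorrelator (criticalCorr 3) ρ n δ (fun i => y i + w) :=
    rescaledCorrelator_eq_of_cellmates _ _ δ hcell
  rw [limit_translate hlim w hx₀] at h1
  rw [limit_translate hlim w hy, ← hF] at h2
  rw [dist_comm] at h1
  calc dist (S n y) (S n x₀)
      ≤ dist (S n y) (rescaledCorrelator (criticalCorr 3) ρ n δ fun i => x₀ i + w) +
          dist (rescaledCorrelator (criticalCorr 3) ρ n δ fun i => x₀ i + w) (S n x₀) :=
        dist_triangle _ _ _
    _ < ε / 3 + ε / 3 := add_lt_add h2 h1
    _ < ε := by linarith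

/-- The crux's instances in particular: under (H2) every `S n` is continuous off the diagonals, with
no use of (H1), (H3)–(H7). [folklore] -/
theorem continuousOn_of_limit (hlim : HasPointwiseScalingLimit (criticalCorr 3) ρ S) :
    ∀ n, ContinuousOn (S n) (NonCoincident 3 n) :=
  fun n => limit_continuousOn hlim n

end Summit.CriticalPhenomena.Ising3DConformalLimit.RotationUpgradeFromTwoPointNegative

end
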